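import Literature.NumberTheory.LocalFields.RamifiedQuadraticOrderUnitIndex     -- ★ B-p04 (g33): `exists_fixed_add_fixed_mul`, `pow_succ_dvd_of_odd_pow_dvd_of_fixed`, `natCard_map_mk_maximalIdeal_pow`
import Literature.NumberTheory.LocalFields.RamifiedQuadraticNormCriterion      -- ★ B-p10 (g26): `residue_map_eq`, `ringChar_residueField_ne_two`
import Literature.NumberTheory.LocalFields.UnramifiedQuadraticNormFixedPoints   -- ★ (L5-c) FILE 1: `maximalIdeal_pow_le_comap`, `quotientMap_mk` (σ-generic parts)
import HarnessLib

/-!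
# Norm fibres modulo `𝔪^n` for a TAMELY RAMIFIED quadratic involution of a discrete valuation ring: `#{x mod 𝔪^n : x σ̄(x) = r̄} = 2 q^{⌊n∕2⌋}`
# (Serre, *Local Fields*, Ch. V §3; Labesse–Langlands 1979, §2 p. 8 «`δ_m = 2q^m`»; Flicker 1998, Prop. 7 p. 84)

Topic `NumberTheory/LocalFields`, namespace `Literature.NumberTheory.LocalFields.RamifiedQuadraticNorm` (= ★ B-p10 `RamifiedQuadraticNormCriterion`).  THEOREMS
ONLY: no definition, no named fact, no instance, no notation, no `sorry`.  Cell `pub/hodgecm-mathlib` (D-0151), crux H413 = `stmt-HodgeConjecture-24833`, road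
«R1-ram» (F0P3-p02 (g12) MEMO-R1ram §4; architect A-p16 (g27) RULING A-15 (b)), brick **R-2 «RAMIFIED TREE COUNTS»**, FILE R2-A (A-p01 (g21), census
`F0/P3a/A-p01/g21/CENSUS-R2-RamifiedTreeCounts.A-p01g21.md`) — the RAMIFIED TWIN of ★ (L5-c) `UnramifiedQuadraticNorm.natCard_norm_fibre_quotient_pow` (`q^{n−1}(q+1)`,
inert): the one new arithmetic input of the ramified lattice counts (self-dual ∕ `ϖ`-modular shells `2q^k` ∕ `2q^{k−1}` about the torus-fixed midpoint; B-p12 (g29) cert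
`TABLE-J-ramified.md` READING (3)).  HONEST LABEL: HC_CM is proved only modulo the printed citations (hLiu418, h413) until rung 0 closes; nothing printed is a letter here.

SETTING (= ★ B-p04 `RamifiedQuadraticOrderUnitIndex`): `S` a DVR with finite residue field `𝓀`, `|𝓀| = q`; `σ` a RESIDUALLY TRIVIAL involution (`σx − x ∈ 𝔪`) with an ANTI-FIXED
uniformiser `ϖ` (`σϖ = −ϖ`); `2 ∈ Sˣ`; `σ̄_n` the induced involution of `S ⧸ 𝔪^n` (★ `maximalIdeal_pow_le_comap`); `r` a `σ`-fixed unit.  Model: `𝒪_w`, `σ_w` at a ramified `w ∣ v ∤ 2`.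
* §1 LIFTING ALGEBRA: `(x+z)σ(x+z) − r = (xσx − r) + (xσz + σ(xσz)) + zσz`; traces of `𝔪^n` lie in `𝔪^{n+1}` for `n` ODD and are `≡ 2c` for `n` EVEN; fixed elements of `𝔪^{odd}`
  lie one step deeper (★ `pow_succ_dvd_of_odd_pow_dvd_of_fixed`) ⇒ ODD STEP (every lift of a solution mod `𝔪^{2i+1}` solves mod `𝔪^{2i+2}`), EVEN STEP (exactly one class of lifts does).
* §2 COUNTING on `S ⧸ 𝔪^n`: reduction maps solutions onto solutions with fibres of size `|𝓀|` (odd, ★ `natCard_map_mk_maximalIdeal_pow`) resp. `1` (even); level `1` = `{±s̄}`.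
* §3 HEAD **`natCard_norm_fibre_quotient_pow_ramified`**: `n ≥ 1`, `r̄` a square ⇒ `Nat.card {x : S ⧸ 𝔪^n // x · σ̄_n x = r̄} = 2 * q ^ (n ∕ 2)`; `= 0` if `r̄` is not a square.

## References
* [Serre1979] J.-P. Serre, *Local Fields*, GTM 67 (1979), Ch. IV §1 Prop. 3; Ch. V §3 Prop. 5 and Cor. 2–3 (totally ramified case, `U_K ∕ N U_L ≅ K̄ˣ ∕ K̄ˣ²`).
* [LabesseLanglands1979] J.-P. Labesse, R. P. Langlands, *L-indistinguishability for SL(2)*, Canad. J. Math. 31 (1979), §2 p. 8 (`δ_m = 2q^m` in the ramified case).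
* [Flicker1998UnitaryFL] Y. Z. Flicker, *Elementary proof of the fundamental lemma for a unitary group*, Canad. J. Math. 50 (1998), Prop. 7 p. 84.
-/

set_option autoImplicit false

namespace Literature.NumberTheory.LocalFields.RamifiedQuadraticNorm

open IsLocalRing Literature.NumberTheory.LocalFields.UnramifiedQuadraticNorm Literature.NumberTheory.LocalFields.RamifiedQuadraticOrder
  Literature.NumberTheory.GaloisRepresentations

universe u

variable {S : Type u} [CommRing S] (σ : S →+* S)

/-! ## §1 Lifting algebra in `S` -/
section Lifting

variable [IsDomain S] [IsDiscreteValuationRing S] (hσ : ∀ x, σ (σ x) = x) (hres : ∀ x, σ x - x ∈ maximalIdeal S)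
  {ϖ : S} (hϖ : Irreducible ϖ) (hσϖ : σ ϖ = -ϖ) (h2 : IsUnit (2 : S))

omit [IsDomain S] [IsDiscreteValuationRing S] in
/-- The norm of a perturbed element: `(x + z)σ(x + z) − r = (xσx − r) + (xσz + σ(xσz)) + zσz` (`σ` an involution). [cite: Serre1979, Ch. V §3] -/
theorem add_mul_map_add_sub_eq (hσ : ∀ x, σ (σ x) = x) (x z r : S) :
    (x + z) * σ (x + z) - r = (x * σ x - r) + (x * σ z + σ (x * σ z)) + z * σ z := by
  rw [map_add, map_mul, hσ]; ring

include hϖ in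
/-- `𝔪^n = (ϖ^n)`: membership in `𝔪^n` is divisibility by `ϖ^n`. [cite: Serre1979, Ch. II §3 Prop. 5] -/
theorem mem_maximalIdeal_pow_iff_dvd (n : ℕ) (x : S) : x ∈ maximalIdeal S ^ n ↔ ϖ ^ n ∣ x := by
  rw [(IsDiscreteValuationRing.irreducible_iff_uniformizer ϖ).1 hϖ, Ideal.span_singleton_pow, Ideal.mem_span_singleton]

include hres hϖ hσϖ in
/-- **Traces of `𝔪^n`, odd `n`**: for `c ∈ 𝔪^{2i+1}`, `c + σ c ∈ 𝔪^{2i+2}` (`c = ϖ^{2i+1} w`, `σ c = −ϖ^{2i+1} σw`, `w − σw ∈ 𝔪`). [cite: Serre1979, Ch. IV §1 Prop. 3] -/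
theorem add_map_mem_pow_succ_of_mem_pow_odd {i : ℕ} {c : S} (hc : c ∈ maximalIdeal S ^ (2 * i + 1)) : c + σ c ∈ maximalIdeal S ^ (2 * i + 2) := by
  rw [mem_maximalIdeal_pow_iff_dvd hϖ] at hc ⊢
  obtain ⟨w, rfl⟩ := hc
  have hσpow : σ (ϖ ^ (2 * i + 1)) = -ϖ ^ (2 * i + 1) := by
    rw [map_pow, hσϖ, neg_pow, pow_succ (-1 : S), pow_mul, neg_one_sq, one_pow, one_mul, neg_one_mul]
  have hw : ϖ ∣ w - σ w := by
    have h1 := hres w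
    rw [(IsDiscreteValuationRing.irreducible_iff_uniformizer ϖ).1 hϖ, Ideal.mem_span_singleton] at h1
    exact dvd_sub_comm.1 h1
  obtain ⟨d, hd⟩ := hw
  refine ⟨d, ?_⟩
  rw [map_mul, hσpow, show ϖ ^ (2 * i + 2) * d = ϖ ^ (2 * i + 1) * (ϖ * d) by ring, ← hd]
  ring

include hres hϖ hσϖ in
/-- **Traces of `𝔪^n`, even `n`**: for `w ∈ S`, `ϖ^{2i} w + σ(ϖ^{2i} w) − 2 ϖ^{2i} w ∈ 𝔪^{2i+1}` (`σ(ϖ^{2i}) = ϖ^{2i}`, `σw − w ∈ 𝔪`). [cite: Serre1979, Ch. IV §1 Prop. 3] -/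
theorem add_map_sub_two_mul_mem_pow_succ_of_even (i : ℕ) (w : S) :
    ϖ ^ (2 * i) * w + σ (ϖ ^ (2 * i) * w) - 2 * (ϖ ^ (2 * i) * w) ∈ maximalIdeal S ^ (2 * i + 1) := by
  have hσpow : σ (ϖ ^ (2 * i)) = ϖ ^ (2 * i) := by rw [map_pow, hσϖ, neg_pow, pow_mul, neg_one_sq, one_pow, one_mul]
  have e : ϖ ^ (2 * i) * w + σ (ϖ ^ (2 * i) * w) - 2 * (ϖ ^ (2 * i) * w) = ϖ ^ (2 * i) * (σ w - w) := by rw [map_mul, hσpow]; ring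
  rw [e, pow_succ]
  have hϖm : ϖ ∈ maximalIdeal S := (mem_maximalIdeal _).2 (mem_nonunits_iff.2 hϖ.not_isUnit)
  exact Ideal.mul_mem_mul (Ideal.pow_mem_pow hϖm _) (hres w)

include hσ hres hϖ hσϖ h2 in
/-- **ODD STEP.**  If `xσx ≡ r (𝔪^{2i+1})` with `σ r = r`, then `(x + z)σ(x + z) ≡ r (𝔪^{2i+2})` for EVERY `z ∈ 𝔪^{2i+1}`: the fixed defect improves by parity, the trace term
`xσz + σ(xσz)` lies in `𝔪^{2i+2}`, and `zσz ∈ 𝔪^{4i+2}`. (Labesse–Langlands' «`∫_{|x|<ε} κ = 0`» ∕ `δ_m = 2q^m` mechanism at a ramified torus.)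
[cite: LabesseLanglands1979, §2 p. 8] [cite: Serre1979, Ch. V §3 Prop. 5] -/
theorem add_mul_map_add_sub_mem_pow_succ_of_odd {i : ℕ} {r x z : S} (hσr : σ r = r) (hx : x * σ x - r ∈ maximalIdeal S ^ (2 * i + 1))
    (hz : z ∈ maximalIdeal S ^ (2 * i + 1)) : (x + z) * σ (x + z) - r ∈ maximalIdeal S ^ (2 * i + 2) := by
  rw [add_mul_map_add_sub_eq σ hσ]
  refine Ideal.add_mem _ (Ideal.add_mem _ ?_ ?_) ?_
  · -- the `σ`-fixed defect `xσx − r ∈ 𝔪^{2i+1}` lies in `𝔪^{2i+2}` (★ fixed elements have even valuation)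
    rw [mem_maximalIdeal_pow_iff_dvd hϖ] at hx ⊢
    exact pow_succ_dvd_of_odd_pow_dvd_of_fixed σ hres hσϖ h2 hϖ (by rw [map_sub, map_mul, hσ, hσr, mul_comm]) hx
  · exact add_map_mem_pow_succ_of_mem_pow_odd σ hres hϖ hσϖ (Ideal.mul_mem_left _ x (map_mem_maximalIdeal_pow σ hσ _ z hz))
  · have hzz : z * σ z ∈ maximalIdeal S ^ (2 * i + 1) * maximalIdeal S ^ (2 * i + 1) := Ideal.mul_mem_mul hz (map_mem_maximalIdeal_pow σ hσ _ z hz)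
    rw [← pow_add] at hzz
    exact Ideal.pow_le_pow_right (by omega) hzz

/-- A solution of `xσx ≡ r (𝔪^n)`, `n ≥ 1`, `r` a unit, is itself a unit. [cite: Serre1979, Ch. V §3] -/
theorem isUnit_of_mul_map_sub_mem_pow {n : ℕ} (hn : 1 ≤ n) {r x : S} (hr : IsUnit r) (hx : x * σ x - r ∈ maximalIdeal S ^ n) :
    IsUnit x := by
  by_contra hxn
  have hxm : x * σ x ∈ maximalIdeal S := Ideal.mul_mem_right _ _ ((mem_maximalIdeal _).2 (mem_nonunits_iff.2 hxn))
  have h1 := Ideal.sub_mem _ hxm (Ideal.pow_le_self (by omega) hx : x * σ x - r ∈ maximalIdeal S)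
  rw [sub_sub_cancel] at h1
  exact (mem_maximalIdeal _).1 h1 hr

include hσ hres hϖ hσϖ h2 in
/-- **EVEN STEP, existence.**  If `xσx ≡ r (𝔪^{2i+2})` with `r` a `σ`-fixed UNIT, some lift `x + ϖ^{2i+2} w` satisfies `N ≡ r (𝔪^{2i+3})`: writing `xσx − r = ϖ^{2i+2} d`,
take `w := σ(−d∕(2x))` (`x` is a unit, `2 ∈ Sˣ`), so that `d + 2 x σw = 0`. [cite: Serre1979, Ch. V §3 Prop. 5] [cite: LabesseLanglands1979, §2 p. 8] -/
theorem exists_add_mul_map_add_sub_mem_pow_succ_of_even {i : ℕ} {r x : S} (hr : IsUnit r)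
    (hx : x * σ x - r ∈ maximalIdeal S ^ (2 * i + 2)) :
    ∃ z ∈ maximalIdeal S ^ (2 * i + 2), (x + z) * σ (x + z) - r ∈ maximalIdeal S ^ (2 * i + 3) := by
  have hxu : IsUnit x := isUnit_of_mul_map_sub_mem_pow σ (by omega) hr hx
  obtain ⟨t, ht⟩ := h2.exists_left_inv   -- `t * 2 = 1`
  obtain ⟨d, hd⟩ := (mem_maximalIdeal_pow_iff_dvd hϖ _ _).1 hx
  have hxinv : x * ↑(hxu.unit⁻¹) = 1 := hxu.mul_val_inv
  set w : S := σ (-(d * t * ↑(hxu.unit⁻¹))) with hw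
  have hσw : d + 2 * x * σ w = 0 := by
    rw [hw, hσ]; linear_combination (-(d * x * ↑(hxu.unit⁻¹))) * ht - d * hxinv
  have hσpow : σ (ϖ ^ (2 * i + 2)) = ϖ ^ (2 * i + 2) := by
    rw [map_pow, hσϖ, neg_pow, show 2 * i + 2 = 2 * (i + 1) by ring, pow_mul, neg_one_sq, one_pow, one_mul]
  have hpow_mem : ϖ ^ (2 * i + 2) ∈ maximalIdeal S ^ (2 * i + 2) := (mem_maximalIdeal_pow_iff_dvd hϖ _ _).2 (dvd_refl _)
  refine ⟨ϖ ^ (2 * i + 2) * w, Ideal.mul_mem_right _ _ hpow_mem, ?_⟩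
  rw [add_mul_map_add_sub_eq σ hσ, hd]
  have e1 : x * σ (ϖ ^ (2 * i + 2) * w) = ϖ ^ (2 * (i + 1)) * (x * σ w) := by
    rw [map_mul, hσpow, show 2 * (i + 1) = 2 * i + 2 by ring]; ring
  have htr := add_map_sub_two_mul_mem_pow_succ_of_even σ hres hϖ hσϖ (i + 1) (x * σ w)
  rw [← e1, show 2 * (i + 1) + 1 = 2 * i + 3 by ring] at htr
  have hzz : ϖ ^ (2 * i + 2) * w * σ (ϖ ^ (2 * i + 2) * w) ∈ maximalIdeal S ^ (2 * i + 3) := by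
    have h1 : ϖ ^ (2 * i + 2) * w ∈ maximalIdeal S ^ (2 * i + 2) := Ideal.mul_mem_right _ _ hpow_mem
    have h12 := Ideal.mul_mem_mul h1 (map_mem_maximalIdeal_pow σ hσ _ _ h1)
    rw [← pow_add] at h12
    exact Ideal.pow_le_pow_right (by omega) h12
  have e2 : ϖ ^ (2 * i + 2) * d + (x * σ (ϖ ^ (2 * i + 2) * w) + σ (x * σ (ϖ ^ (2 * i + 2) * w))) + ϖ ^ (2 * i + 2) * w * σ (ϖ ^ (2 * i + 2) * w)
      = (x * σ (ϖ ^ (2 * i + 2) * w) + σ (x * σ (ϖ ^ (2 * i + 2) * w)) - 2 * (x * σ (ϖ ^ (2 * i + 2) * w)))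
        + ϖ ^ (2 * i + 2) * w * σ (ϖ ^ (2 * i + 2) * w) := by
    rw [e1, show 2 * (i + 1) = 2 * i + 2 by ring]
    linear_combination ϖ ^ (2 * i + 2) * hσw
  rw [e2]
  exact Ideal.add_mem _ htr hzz

include hσ hres hϖ hσϖ h2 in
/-- **EVEN STEP, uniqueness.**  If `z, z′ ∈ 𝔪^{2i+2}` both lift a unit-norm solution `x` to level `𝔪^{2i+3}`, then `z ≡ z′ (𝔪^{2i+3})`: the difference of the two
expansions is the trace `c + σc`, `c = x σ(z − z′) ≡ 2c`, so `2 x σ(z − z′)∕ϖ^{2i+2} ∈ 𝔪`. [cite: Serre1979, Ch. V §3 Prop. 5] [cite: LabesseLanglands1979, §2 p. 8] -/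
theorem sub_mem_pow_succ_of_even {i : ℕ} {r x z z' : S} (hr : IsUnit r)
    (hx : x * σ x - r ∈ maximalIdeal S ^ (2 * i + 2))
    (hz : z ∈ maximalIdeal S ^ (2 * i + 2)) (hz' : z' ∈ maximalIdeal S ^ (2 * i + 2))
    (hNz : (x + z) * σ (x + z) - r ∈ maximalIdeal S ^ (2 * i + 3)) (hNz' : (x + z') * σ (x + z') - r ∈ maximalIdeal S ^ (2 * i + 3)) :
    z - z' ∈ maximalIdeal S ^ (2 * i + 3) := by
  have hxu : IsUnit x := isUnit_of_mul_map_sub_mem_pow σ (by omega) hr hx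
  have hσpow : σ (ϖ ^ (2 * i + 2)) = ϖ ^ (2 * i + 2) := by
    rw [map_pow, hσϖ, neg_pow, show 2 * i + 2 = 2 * (i + 1) by ring, pow_mul, neg_one_sq, one_pow, one_mul]
  obtain ⟨w, hw⟩ := (mem_maximalIdeal_pow_iff_dvd hϖ _ _).1 (Ideal.sub_mem _ hz hz')
  have hsq : ∀ {y : S}, y ∈ maximalIdeal S ^ (2 * i + 2) → y * σ y ∈ maximalIdeal S ^ (2 * i + 3) := fun {y} hy => by
    have h12 := Ideal.mul_mem_mul hy (map_mem_maximalIdeal_pow σ hσ _ _ hy)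
    rw [← pow_add] at h12
    exact Ideal.pow_le_pow_right (by omega) h12
  -- the difference of the two expansions
  have hdiff : (x * σ (ϖ ^ (2 * i + 2) * w) + σ (x * σ (ϖ ^ (2 * i + 2) * w))) ∈ maximalIdeal S ^ (2 * i + 3) := by
    have e : x * σ (ϖ ^ (2 * i + 2) * w) + σ (x * σ (ϖ ^ (2 * i + 2) * w))
        = ((x + z) * σ (x + z) - r) - ((x + z') * σ (x + z') - r) - z * σ z + z' * σ z' := by
      simp only [← hw, map_sub, map_mul, map_add, hσ]; ring
    rw [e]
    exact Ideal.add_mem _ (Ideal.sub_mem _ (Ideal.sub_mem _ hNz hNz') (hsq hz)) (hsq hz')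
  -- `≡ 2 ϖ^n x σw`, hence `2 x σ w ∈ 𝔪`
  have e1 : x * σ (ϖ ^ (2 * i + 2) * w) = ϖ ^ (2 * (i + 1)) * (x * σ w) := by
    rw [map_mul, hσpow, show 2 * (i + 1) = 2 * i + 2 by ring]; ring
  have htr := add_map_sub_two_mul_mem_pow_succ_of_even σ hres hϖ hσϖ (i + 1) (x * σ w)
  rw [← e1, show 2 * (i + 1) + 1 = 2 * i + 3 by ring] at htr
  have h2w : 2 * (x * σ (ϖ ^ (2 * i + 2) * w)) ∈ maximalIdeal S ^ (2 * i + 3) := by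
    have := Ideal.sub_mem _ hdiff htr
    rwa [sub_sub_cancel] at this
  rw [e1, show 2 * (i + 1) = 2 * i + 2 by ring, mem_maximalIdeal_pow_iff_dvd hϖ, pow_succ,
    show 2 * (ϖ ^ (2 * i + 2) * (x * σ w)) = ϖ ^ (2 * i + 2) * (2 * (x * σ w)) by ring,
    mul_dvd_mul_iff_left (pow_ne_zero _ hϖ.ne_zero)] at h2w
  have hσwm : σ w ∈ maximalIdeal S := by
    have h1 : 2 * (x * σ w) ∈ maximalIdeal S := by
      rw [(IsDiscreteValuationRing.irreducible_iff_uniformizer ϖ).1 hϖ, Ideal.mem_span_singleton]; exact h2w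
    rw [← mul_assoc, Ideal.unit_mul_mem_iff_mem _ (h2.mul hxu)] at h1
    exact h1
  have hwm : w ∈ maximalIdeal S := by
    have := map_mem_maximalIdeal σ hσ _ hσwm
    rwa [hσ] at this
  rw [hw, pow_succ]
  exact Ideal.mul_mem_mul ((mem_maximalIdeal_pow_iff_dvd hϖ _ _).2 (dvd_refl _)) hwm

end Lifting

/-! ## §2 Counting on `S ⧸ 𝔪^n`: representatives, the reduction map, the odd and even steps, level `1` -/
section Counting

variable [IsDomain S] [IsDiscreteValuationRing S] (hσ : ∀ x, σ (σ x) = x) (hres : ∀ x, σ x - x ∈ maximalIdeal S)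
  {ϖ : S} (hϖ : Irreducible ϖ) (hσϖ : σ ϖ = -ϖ) (h2 : IsUnit (2 : S))

/-- REPRESENTATIVES: `mk a` solves `y · σ̄_n y = r̄` in `S ⧸ 𝔪^n` iff `a σa − r ∈ 𝔪^n`. [cite: Serre1979, Ch. V §3] -/
theorem mk_mul_quotientMap_mk_eq_iff (n : ℕ) (r a : S) :
    Ideal.Quotient.mk (maximalIdeal S ^ n) a *
        Ideal.quotientMap (maximalIdeal S ^ n) σ (maximalIdeal_pow_le_comap σ hσ n) (Ideal.Quotient.mk (maximalIdeal S ^ n) a) =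
      Ideal.Quotient.mk (maximalIdeal S ^ n) r ↔ a * σ a - r ∈ maximalIdeal S ^ n := by
  rw [Ideal.quotientMap_mk, ← map_mul, Ideal.Quotient.eq]

/-- The reduction `S ⧸ 𝔪^{n+1} → S ⧸ 𝔪^n` commutes with `σ̄`, so it maps solutions to solutions. [cite: Serre1979, Ch. V §3] -/
theorem factor_mul_quotientMap_factor_eq {n : ℕ} {r : S} {y : S ⧸ maximalIdeal S ^ (n + 1)}
    (hy : y * Ideal.quotientMap (maximalIdeal S ^ (n + 1)) σ (maximalIdeal_pow_le_comap σ hσ (n + 1)) y = Ideal.Quotient.mk _ r) :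
    Ideal.Quotient.factor (Ideal.pow_le_pow_right (Nat.le_succ n)) y *
        Ideal.quotientMap (maximalIdeal S ^ n) σ (maximalIdeal_pow_le_comap σ hσ n) (Ideal.Quotient.factor (Ideal.pow_le_pow_right (Nat.le_succ n)) y) =
      Ideal.Quotient.mk (maximalIdeal S ^ n) r := by
  obtain ⟨a, rfl⟩ := Ideal.Quotient.mk_surjective y
  rw [mk_mul_quotientMap_mk_eq_iff σ hσ] at hy
  rw [Ideal.Quotient.factor_mk, mk_mul_quotientMap_mk_eq_iff σ hσ]
  exact Ideal.pow_le_pow_right (Nat.le_succ n) hy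

/-- **Each fibre of the reduction has `|𝓀|` elements**: `#{y ∈ S ⧸ 𝔪^{n+1} : y ↦ t} = |𝔪^n ∕ 𝔪^{n+1}| = |𝓀|` for every `t` (translate to the kernel fibre = the image of
`𝔪^n`, ★ `natCard_map_mk_maximalIdeal_pow`). [cite: Serre1979, Ch. II §3 Prop. 5] -/
theorem natCard_fibre_factor_eq [Finite (ResidueField S)] (n : ℕ) (t : S ⧸ maximalIdeal S ^ n) :
    Nat.card {y : S ⧸ maximalIdeal S ^ (n + 1) // Ideal.Quotient.factor (Ideal.pow_le_pow_right (Nat.le_succ n)) y = t} =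
      Nat.card (ResidueField S) := by
  have hle : maximalIdeal S ^ (n + 1) ≤ maximalIdeal S ^ n := Ideal.pow_le_pow_right (Nat.le_succ n)
  obtain ⟨a, rfl⟩ := Ideal.Quotient.mk_surjective t
  rw [← natCard_map_mk_maximalIdeal_pow (S := S) n]
  have key : ∀ y : S ⧸ maximalIdeal S ^ (n + 1),
      Ideal.Quotient.factor hle y = Ideal.Quotient.mk _ a ↔ y - Ideal.Quotient.mk _ a ∈ (maximalIdeal S ^ n).map (Ideal.Quotient.mk (maximalIdeal S ^ (n + 1))) := by
    intro y
    obtain ⟨b, rfl⟩ := Ideal.Quotient.mk_surjective y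
    rw [Ideal.Quotient.factor_mk, Ideal.Quotient.eq, ← map_sub, Ideal.mem_quotient_iff_mem hle]
  refine Nat.card_congr
    { toFun := fun y => ⟨y.1 - Ideal.Quotient.mk _ a, (key y.1).1 y.2⟩
      invFun := fun k => ⟨k.1 + Ideal.Quotient.mk _ a, (key _).2 (by rw [add_sub_cancel_right]; exact k.2)⟩
      left_inv := fun y => by simp
      right_inv := fun k => by simp }

include hres hϖ hσϖ h2 in
/-- **ODD STEP on the quotients** (`n = 2i+1`): the solutions mod `𝔪^{n+1}` are EXACTLY the lifts of the solutions mod `𝔪^n`, so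
`#Sol(𝔪^{n+1}) = |𝓀| · #Sol(𝔪^n)`. [cite: LabesseLanglands1979, §2 p. 8] [cite: Serre1979, Ch. V §3 Prop. 5] -/
theorem natCard_sol_succ_of_odd [Finite (ResidueField S)] (i : ℕ) {r : S} (hσr : σ r = r) :
    Nat.card {y : S ⧸ maximalIdeal S ^ (2 * i + 1 + 1) //
        y * Ideal.quotientMap (maximalIdeal S ^ (2 * i + 1 + 1)) σ (maximalIdeal_pow_le_comap σ hσ (2 * i + 1 + 1)) y = Ideal.Quotient.mk _ r} =
      Nat.card (ResidueField S) *
        Nat.card {x : S ⧸ maximalIdeal S ^ (2 * i + 1) //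
          x * Ideal.quotientMap (maximalIdeal S ^ (2 * i + 1)) σ (maximalIdeal_pow_le_comap σ hσ (2 * i + 1)) x = Ideal.Quotient.mk _ r} := by
  classical
  haveI : Finite (S ⧸ maximalIdeal S ^ (2 * i + 1)) := CompleteLocalRing.finite_quotient_maximalIdeal_pow (R := S) _
  haveI : Finite (S ⧸ maximalIdeal S ^ (2 * i + 1 + 1)) := CompleteLocalRing.finite_quotient_maximalIdeal_pow (R := S) _
  have hle : maximalIdeal S ^ (2 * i + 1 + 1) ≤ maximalIdeal S ^ (2 * i + 1) := Ideal.pow_le_pow_right (Nat.le_succ _)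
  let ρS : {y : S ⧸ maximalIdeal S ^ (2 * i + 1 + 1) //
        y * Ideal.quotientMap _ σ (maximalIdeal_pow_le_comap σ hσ (2 * i + 1 + 1)) y = Ideal.Quotient.mk _ r} →
      {x : S ⧸ maximalIdeal S ^ (2 * i + 1) // x * Ideal.quotientMap _ σ (maximalIdeal_pow_le_comap σ hσ (2 * i + 1)) x = Ideal.Quotient.mk _ r} :=
    fun y => ⟨Ideal.Quotient.factor hle y.1, factor_mul_quotientMap_factor_eq σ hσ y.2⟩
  -- a lift of a solution mod `𝔪^{2i+1}` is a solution mod `𝔪^{2i+2}` (odd step with `z = 0`)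
  have hlift : ∀ y : S ⧸ maximalIdeal S ^ (2 * i + 1 + 1),
      Ideal.Quotient.factor hle y * Ideal.quotientMap _ σ (maximalIdeal_pow_le_comap σ hσ (2 * i + 1)) (Ideal.Quotient.factor hle y) =
        Ideal.Quotient.mk _ r →
      y * Ideal.quotientMap _ σ (maximalIdeal_pow_le_comap σ hσ (2 * i + 1 + 1)) y = Ideal.Quotient.mk _ r := by
    intro y hy
    obtain ⟨b, rfl⟩ := Ideal.Quotient.mk_surjective y
    rw [Ideal.Quotient.factor_mk, mk_mul_quotientMap_mk_eq_iff σ hσ] at hy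
    rw [mk_mul_quotientMap_mk_eq_iff σ hσ]
    have := add_mul_map_add_sub_mem_pow_succ_of_odd σ hσ hres hϖ hσϖ h2 hσr hy (Ideal.zero_mem _)
    rwa [add_zero] at this
  have hfib : ∀ t, Nat.card {y // ρS y = t} = Nat.card (ResidueField S) := by
    intro t
    rw [← natCard_fibre_factor_eq (S := S) (2 * i + 1) t.1]
    exact Nat.card_congr
      { toFun := fun y => ⟨y.1.1, congrArg Subtype.val y.2⟩
        invFun := fun y => ⟨⟨y.1, hlift y.1 (by rw [y.2]; exact t.2)⟩, Subtype.ext y.2⟩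
        left_inv := fun y => rfl
        right_inv := fun y => rfl }
  letI := Fintype.ofFinite {x : S ⧸ maximalIdeal S ^ (2 * i + 1) //
    x * Ideal.quotientMap _ σ (maximalIdeal_pow_le_comap σ hσ (2 * i + 1)) x = Ideal.Quotient.mk _ r}
  rw [← Nat.card_congr (Equiv.sigmaFiberEquiv ρS), Nat.card_sigma, Finset.sum_congr rfl (fun t _ => hfib t), Finset.sum_const, Finset.card_univ,
    smul_eq_mul, ← Nat.card_eq_fintype_card, mul_comm]

include hres hϖ hσϖ h2 in
/-- **EVEN STEP on the quotients** (`n = 2i+2`, `r` a unit): reduction is a BIJECTION between the solutions mod `𝔪^{n+1}` and mod `𝔪^n`, so the counts agree.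
[cite: LabesseLanglands1979, §2 p. 8] [cite: Serre1979, Ch. V §3 Prop. 5] -/
theorem natCard_sol_succ_of_even (i : ℕ) {r : S} (hr : IsUnit r) :
    Nat.card {y : S ⧸ maximalIdeal S ^ (2 * i + 2 + 1) //
        y * Ideal.quotientMap (maximalIdeal S ^ (2 * i + 2 + 1)) σ (maximalIdeal_pow_le_comap σ hσ (2 * i + 2 + 1)) y = Ideal.Quotient.mk _ r} =
      Nat.card {x : S ⧸ maximalIdeal S ^ (2 * i + 2) //
          x * Ideal.quotientMap (maximalIdeal S ^ (2 * i + 2)) σ (maximalIdeal_pow_le_comap σ hσ (2 * i + 2)) x = Ideal.Quotient.mk _ r} := by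
  have hle : maximalIdeal S ^ (2 * i + 2 + 1) ≤ maximalIdeal S ^ (2 * i + 2) := Ideal.pow_le_pow_right (Nat.le_succ _)
  let ρS : {y : S ⧸ maximalIdeal S ^ (2 * i + 2 + 1) //
        y * Ideal.quotientMap _ σ (maximalIdeal_pow_le_comap σ hσ (2 * i + 2 + 1)) y = Ideal.Quotient.mk _ r} →
      {x : S ⧸ maximalIdeal S ^ (2 * i + 2) // x * Ideal.quotientMap _ σ (maximalIdeal_pow_le_comap σ hσ (2 * i + 2)) x = Ideal.Quotient.mk _ r} :=
    fun y => ⟨Ideal.Quotient.factor hle y.1, factor_mul_quotientMap_factor_eq σ hσ y.2⟩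
  refine Nat.card_eq_of_bijective ρS ⟨fun y y' hyy => ?_, fun t => ?_⟩
  · -- injective: two solutions over the same point differ by an element of `𝔪^{n+1}` (even step, uniqueness)
    obtain ⟨b, hb⟩ := Ideal.Quotient.mk_surjective y.1
    obtain ⟨b', hb'⟩ := Ideal.Quotient.mk_surjective y'.1
    have hy : b * σ b - r ∈ maximalIdeal S ^ (2 * i + 2 + 1) := (mk_mul_quotientMap_mk_eq_iff σ hσ _ r b).1 (by rw [hb]; exact y.2)
    have hy' : b' * σ b' - r ∈ maximalIdeal S ^ (2 * i + 2 + 1) := (mk_mul_quotientMap_mk_eq_iff σ hσ _ r b').1 (by rw [hb']; exact y'.2)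
    have hρρ : b - b' ∈ maximalIdeal S ^ (2 * i + 2) := by
      have h1 : Ideal.Quotient.factor hle y.1 = Ideal.Quotient.factor hle y'.1 := congrArg Subtype.val hyy
      rwa [← hb, ← hb', Ideal.Quotient.factor_mk, Ideal.Quotient.factor_mk, Ideal.Quotient.eq] at h1
    apply Subtype.ext
    rw [← hb, ← hb', Ideal.Quotient.eq]
    have hx : b' * σ b' - r ∈ maximalIdeal S ^ (2 * i + 2) := hle hy'
    have hz : (b' + (b - b')) * σ (b' + (b - b')) - r ∈ maximalIdeal S ^ (2 * i + 3) := by rwa [add_sub_cancel]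
    have hz' : (b' + 0) * σ (b' + 0) - r ∈ maximalIdeal S ^ (2 * i + 3) := by rwa [add_zero]
    have := sub_mem_pow_succ_of_even σ hσ hres hϖ hσϖ h2 hr hx hρρ (Ideal.zero_mem _) hz hz'
    rwa [sub_zero] at this
  · -- surjective: even step, existence
    obtain ⟨a, ha⟩ := Ideal.Quotient.mk_surjective t.1
    have ht : a * σ a - r ∈ maximalIdeal S ^ (2 * i + 2) := (mk_mul_quotientMap_mk_eq_iff σ hσ _ r a).1 (by rw [ha]; exact t.2)
    obtain ⟨z, hz, hNz⟩ := exists_add_mul_map_add_sub_mem_pow_succ_of_even σ hσ hres hϖ hσϖ h2 hr ht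
    refine ⟨⟨Ideal.Quotient.mk _ (a + z), (mk_mul_quotientMap_mk_eq_iff σ hσ _ _ _).2 hNz⟩, Subtype.ext ?_⟩
    show Ideal.Quotient.factor hle (Ideal.Quotient.mk _ (a + z)) = t.1
    rw [Ideal.Quotient.factor_mk, ← ha, Ideal.Quotient.eq, add_sub_cancel_left]
    exact hz

include hres h2 in
/-- **LEVEL `1`**: in `S ⧸ 𝔪^1 ≅ 𝓀` (`σ̄ = id`) the solutions of `y σ̄y = r̄` are the square roots `±s̄` of `r̄ = s̄²`, `s̄ ≠ 0` (`r` a unit), and `s̄ ≠ −s̄` (`2 ∈ Sˣ`): TWO of them.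
[cite: Serre1979, Ch. V §3 Cor. 2] -/
theorem natCard_sol_one {r : S} (hr : IsUnit r) (hsq : IsSquare (residue S r)) :
    Nat.card {y : S ⧸ maximalIdeal S ^ 1 // y * Ideal.quotientMap (maximalIdeal S ^ 1) σ (maximalIdeal_pow_le_comap σ hσ 1) y = Ideal.Quotient.mk _ r} = 2 := by
  obtain ⟨s, hs⟩ := hsq
  have hs0 : s ≠ 0 := by
    rintro rfl
    rw [mul_zero, residue_eq_zero_iff] at hs
    exact (mem_maximalIdeal _).1 hs hr
  have h2k : (2 : ResidueField S) ≠ 0 := by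
    have := (h2.map (residue S)).ne_zero
    rwa [map_ofNat] at this
  have hne : s ≠ -s := fun h => hs0 ((mul_eq_zero.1 (show (2 : ResidueField S) * s = 0 by linear_combination h)).resolve_left h2k)
  let e : S ⧸ maximalIdeal S ^ 1 ≃+* ResidueField S := Ideal.quotEquivOfEq (pow_one (maximalIdeal S))
  have he : ∀ a, e (Ideal.Quotient.mk _ a) = residue S a := fun a => Ideal.quotEquivOfEq_mk _ _
  have hset : {a : ResidueField S | a ^ 2 = s ^ 2} = {s, -s} := by
    ext a
    simp only [Set.mem_setOf_eq, Set.mem_insert_iff, Set.mem_singleton_iff]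
    exact sq_eq_sq_iff_eq_or_eq_neg
  rw [← Set.ncard_pair hne, ← hset, ← Nat.card_coe_set_eq, Set.coe_setOf]
  refine Nat.card_congr (e.toEquiv.subtypeEquiv fun y => ?_)
  obtain ⟨a, rfl⟩ := Ideal.Quotient.mk_surjective y
  show _ ↔ e (Ideal.Quotient.mk _ a) ^ 2 = s ^ 2
  rw [he, mk_mul_quotientMap_mk_eq_iff σ hσ, sq s, ← hs]
  have hm1 : a * σ a - r ∈ maximalIdeal S ^ 1 ↔ r - a * σ a ∈ maximalIdeal S := by rw [pow_one, ← Ideal.neg_mem_iff, neg_sub]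
  rw [hm1, ← residue_eq_zero_iff, map_sub, sub_eq_zero, map_mul, residue_map_eq σ hres, sq, eq_comm]

/-! ## §3 The head: `#{x ∈ S ⧸ 𝔪^n : x σ̄_n x = r̄} = 2 q^{⌊n∕2⌋}` -/

include hres hϖ hσϖ h2 in
/-- The two-step recursion resolved: `#Sol(𝔪^{2i+1}) = 2q^i` and `#Sol(𝔪^{2i+2}) = 2q^{i+1}` (`r` a `σ`-fixed unit with square residue, `|𝓀| = q`).
[cite: LabesseLanglands1979, §2 p. 8] [cite: Serre1979, Ch. V §3 Prop. 5 and Cor. 2] -/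
theorem natCard_sol_odd_and_even [Finite (ResidueField S)] {q : ℕ} (hq : Nat.card (ResidueField S) = q) {r : S} (hr : IsUnit r) (hσr : σ r = r)
    (hsq : IsSquare (residue S r)) (i : ℕ) :
    Nat.card {y : S ⧸ maximalIdeal S ^ (2 * i + 1) //
        y * Ideal.quotientMap (maximalIdeal S ^ (2 * i + 1)) σ (maximalIdeal_pow_le_comap σ hσ (2 * i + 1)) y = Ideal.Quotient.mk _ r} = 2 * q ^ i ∧
    Nat.card {y : S ⧸ maximalIdeal S ^ (2 * i + 2) //
        y * Ideal.quotientMap (maximalIdeal S ^ (2 * i + 2)) σ (maximalIdeal_pow_le_comap σ hσ (2 * i + 2)) y = Ideal.Quotient.mk _ r} = 2 * q ^ (i + 1) := by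
  induction i with
  | zero =>
    have h1 := natCard_sol_one σ hσ hres h2 hr hsq
    have h12 := natCard_sol_succ_of_odd σ hσ hres hϖ hσϖ h2 0 hσr   -- level 2 from level 1 (odd step at `n = 1`)
    simp only [Nat.mul_zero, Nat.zero_add] at h12 ⊢
    exact ⟨by simpa using h1, by rw [h12, h1, hq]; ring⟩
  | succ i ih =>
    have h3 : Nat.card {y : S ⧸ maximalIdeal S ^ (2 * (i + 1) + 1) //
        y * Ideal.quotientMap (maximalIdeal S ^ (2 * (i + 1) + 1)) σ (maximalIdeal_pow_le_comap σ hσ (2 * (i + 1) + 1)) y = Ideal.Quotient.mk _ r} =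
        2 * q ^ (i + 1) := by
      rw [show 2 * (i + 1) + 1 = 2 * i + 2 + 1 by ring, natCard_sol_succ_of_even σ hσ hres hϖ hσϖ h2 i hr, ih.2]
    refine ⟨h3, ?_⟩
    rw [show 2 * (i + 1) + 2 = 2 * (i + 1) + 1 + 1 by ring, natCard_sol_succ_of_odd σ hσ hres hϖ hσϖ h2 (i + 1) hσr, h3, hq]; ring

include hres hϖ hσϖ h2 in
/-- **THE RAMIFIED NORM FIBRES MODULO `𝔪^n`.**  `S` a discrete valuation ring with finite residue field of cardinality `q`; `σ` a residually trivial involution with an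
anti-fixed uniformiser `ϖ` (`σϖ = −ϖ`), `2 ∈ Sˣ` (a TAMELY RAMIFIED quadratic involution); `r` a `σ`-fixed unit whose residue is a SQUARE (⟺ `r` is a norm,
★ `exists_mul_map_eq_iff_isSquare_residue`).  Then for every `n ≥ 1`:  `#{x ∈ S ⧸ 𝔪^n : x · σ̄_n(x) = r̄} = 2 · q^{⌊n∕2⌋}`
(inert twin: ★ `UnramifiedQuadraticNorm.natCard_norm_fibre_quotient_pow`, `q^{n−1}(q+1)`) — the gluing weights `2q^k` (`n = 2k`, self-dual) ∕ `2q^{k−1}` (`n = 2k−1`,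
`ϖ`-modular) of the lattices of depth `k` about the midpoint fixed by an elliptic torus of `U(1,1)` at a ramified place: Labesse–Langlands' `δ_m = 2q^m`.
[cite: LabesseLanglands1979, §2 p. 8] [cite: Serre1979, Ch. V §3 Prop. 5 and Cor. 2–3] [cite: Flicker1998UnitaryFL, Prop. 7 p. 84] -/
theorem natCard_norm_fibre_quotient_pow_ramified [Finite (ResidueField S)] {q : ℕ} (hq : Nat.card (ResidueField S) = q) {n : ℕ} (hn : 1 ≤ n)
    {r : S} (hr : IsUnit r) (hσr : σ r = r) (hsq : IsSquare (residue S r)) :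
    Nat.card {y : S ⧸ maximalIdeal S ^ n //
        y * Ideal.quotientMap (maximalIdeal S ^ n) σ (maximalIdeal_pow_le_comap σ hσ n) y = Ideal.Quotient.mk _ r} = 2 * q ^ (n / 2) := by
  obtain ⟨i, rfl | rfl⟩ := Nat.even_or_odd' n
  · obtain ⟨j, rfl⟩ : ∃ j, i = j + 1 := ⟨i - 1, by omega⟩   -- `n = 2i`, `i ≥ 1`
    rw [show 2 * (j + 1) = 2 * j + 2 by ring, (natCard_sol_odd_and_even σ hσ hres hϖ hσϖ h2 hq hr hσr hsq j).2, show (2 * j + 2) / 2 = j + 1 by omega]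
  · rw [(natCard_sol_odd_and_even σ hσ hres hϖ hσϖ h2 hq hr hσr hsq i).1, show (2 * i + 1) / 2 = i by omega]

include hres in
/-- **Non-norms have EMPTY fibres**: if `r̄` is not a square, `x · σ̄_n(x) = r̄` has no solution in `S ⧸ 𝔪^n`, `n ≥ 1` (reduce to `𝓀`, where `σ̄ = id`).
[cite: Serre1979, Ch. V §3 Cor. 2] -/
theorem natCard_norm_fibre_quotient_pow_ramified_eq_zero_of_not_isSquare {n : ℕ} (hn : 1 ≤ n) {r : S} (hsq : ¬ IsSquare (residue S r)) :
    Nat.card {y : S ⧸ maximalIdeal S ^ n //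
        y * Ideal.quotientMap (maximalIdeal S ^ n) σ (maximalIdeal_pow_le_comap σ hσ n) y = Ideal.Quotient.mk _ r} = 0 := by
  have hle : maximalIdeal S ^ n ≤ maximalIdeal S := Ideal.pow_le_self (by omega)
  refine @Nat.card_of_isEmpty _ ⟨fun y => hsq ?_⟩
  obtain ⟨a, ha⟩ := Ideal.Quotient.mk_surjective y.1
  have h1 : r - a * σ a ∈ maximalIdeal S := by
    rw [← neg_sub, Ideal.neg_mem_iff]
    exact hle ((mk_mul_quotientMap_mk_eq_iff σ hσ _ r a).1 (by rw [ha]; exact y.2))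
  have h3 : residue S r = residue S (a * σ a) := by rw [← sub_eq_zero, ← map_sub, residue_eq_zero_iff]; exact h1
  exact ⟨residue S a, by rw [h3, map_mul, residue_map_eq σ hres]⟩

end Counting

end Literature.NumberTheory.LocalFields.RamifiedQuadraticNorm
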